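import Summits.Ventures.PercRepro.S1RankProfileDoubleCount

/-!
# PercRepro — A CIRCUIT HAS AT LEAST THREE ELEMENTS WHEN ALL PAIRS HAVE RANK 2 (p2, gen 28; SUBCLAIM-S1 §6.10)

The empty set, singletons and pairs are independent when all pairs have rank `2` (and the ground set has `≥ 2`
points), so a circuit has `≥ 3` elements. Nothing is claimed about any cell.

* `three_le_ncard_of_isCircuit_of_pairs`.
Axioms: standard.
-/

open scoped Matroid

namespace PercRepro

namespace S1

open Set

variable {α : Type}

/-- A circuit of a matroid in which all pairs have rank `2` (and with at least `2` points) has at least `3` elements. -/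
theorem three_le_ncard_of_isCircuit_of_pairs (M : Matroid α) [M.Finite]
    (hpairs : ∀ e ∈ M.E, ∀ f ∈ M.E, e ≠ f → M.eRk {e, f} = 2) (h2 : 2 ≤ M.E.ncard) {C : Set α}
    (hC : M.IsCircuit C) : 3 ≤ C.ncard := by
  have hCE := hC.subset_ground
  have hCfin : C.Finite := M.ground_finite.subset hCE
  by_contra hlt
  push Not at hlt
  apply hC.dep.not_indep
  -- `C` has at most `2` elements: its rank equals its size, so it is independent
  have hrk : M.eRk C = C.encard := by
    rcases Nat.lt_or_ge C.ncard 2 with h1 | h1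
    · rcases Nat.lt_or_ge C.ncard 1 with h0 | h0
      · have : C = ∅ := (ncard_eq_zero hCfin).mp (by omega)
        subst this
        rw [M.eRk_empty, encard_empty]
      · obtain ⟨x, hx⟩ := ncard_eq_one.mp (by omega : C.ncard = 1)
        subst hx
        have hxE : x ∈ M.E := hCE (mem_singleton x)
        obtain ⟨y, hy, hxy⟩ : ∃ y ∈ M.E, x ≠ y := by
          by_contra hno
          push Not at hno
          have hE1 : M.E ⊆ {x} := fun y hy => by rw [mem_singleton_iff]; exact (hno y hy).symm
          have := ncard_le_ncard hE1 (finite_singleton x)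
          rw [ncard_singleton] at this
          omega
        have hp := hpairs x hxE y hy hxy
        have hle : M.eRk {x, y} ≤ M.eRk {x} + 1 := by
          rw [show ({x, y} : Set α) = insert y {x} from pair_comm x y]
          exact M.eRk_insert_le_add_one y {x}
        rw [hp] at hle
        have hle1 : M.eRk {x} ≤ 1 := by
          have := M.eRk_le_encard {x}
          rwa [encard_singleton] at this
        rw [encard_singleton]
        refine le_antisymm hle1 ?_
        by_contra hlt1
        push Not at hlt1
        obtain ⟨n, hn⟩ := ENat.ne_top_iff_exists.mp (ne_top_of_le_ne_top (by decide) hle1)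
        rw [← hn] at hlt1 hle
        have hn0 : n < 1 := by exact_mod_cast hlt1
        rw [show n = 0 by omega] at hle
        exact absurd hle (by decide)
    · obtain ⟨x, y, hxy, rfl⟩ := ncard_eq_two.mp (by omega : C.ncard = 2)
      rw [hpairs x (hCE (by simp)) y (hCE (by simp)) hxy, encard_pair hxy]
  exact (Matroid.indep_iff_eRk_eq_encard_of_finite hCfin).mpr hrk

end S1

end PercRepro
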